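import Summits.HodgeConjecture.CorCM.MultiFieldWeilMerge
import Summits.HodgeConjecture.CorCM.SexticDecicWeilSixfoldParts
import Summits.HodgeConjecture.CorCM.SexticOcticWeilSixfoldParts
import HarnessLib

/-!
# COR-CM — MULTI-FIELD WEIL, part 8: the three MARKMAN-TYPE WEIL SPACES in the generic frame — `T ⊞ E` (sextic `(1,2)`-slot, fourfold theorem),
# `B₄ ⊞ E ⊞ E` (octic `(1,3)`-slot, hyperbolic-sixfold theorem), `B₅ ⊞ E` (decic `(2,3)`-slot, hyperbolic-sixfold theorem)

Cell `pub-hodgecm2` (COR-CM), seat b30 gen 28 (2026-08-23); count-neutral own lane MULTI-FIELD WEIL ENGINE; optional sequel of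
`CorCM/MultiFieldWeilMerge.lean` supplying the hypothesis `hW m` of the generic headline `MultiFieldWeil.hodgeConjectureFor_biproduct_comp_of_defectLawG`
for the three slot shapes with a known Markman-type input, for ANY slot `m` of ANY multi-field frame.  Theorems only; no definition, no named fact,
no `sorry`.  Inputs BY NAME: b24ʼs `WeilFourfold.weilClassesOf_le_algebraicClasses_cmThreefold_biprod_cmCurve` + gen 26ʼs
`SexticOcticWeil.typeCount_fourfold_of_frameS`; gen 18ʼs `OcticCurveFourfold.…_of_markmanSixfold` + gen 25ʼs `OcticWeilMulti.typeCount_sixfold_of_frameO`;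
b09ʼs `DecicCurveFivefold.…_of_markmanSixfold` + gen 27ʼs `SexticDecicWeil.typeCount_sixfold_of_frameSD`; the product-to-biproduct conversions
`DihedralSexticPairCurve.weilClassesOf_biproduct_le_algebraicClasses_of_biprod`, `OcticCurveFourfold.weilClassesOf_biproduct₃_le_algebraicClasses_of_prod`,
`PairWeights.weilClassesOf_biproduct_le_algebraicClasses_of_prod`.
HONEST FRAMING: nothing about the Hodge conjecture is concluded here; `HC_CM` is not asserted; the Markman facts are displayed hypotheses.
[cite: Markman2025SurveySecant, Thm. 1.2] [cite: Markman2025SecantWeil, Thm 1.5.1] [cite: vanGeemen1994HodgeAV, 4.9–4.10] [cite: Deligne1982HodgeCycles, §5 (c)]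

## References
* [Markman2025SurveySecant] E. Markman, survey, Thm. 1.2.  [Markman2025SecantWeil] E. Markman, Thm 1.5.1.  [vanGeemen1994HodgeAV] B. van Geemen,
  LNM 1594 (1994), 4.9–4.10.  [Deligne1982HodgeCycles] P. Deligne, LNM 900 (1982), §5 (c).
-/

noncomputable section

open CategoryTheory CategoryTheory.Limits NumberField

namespace Summit.HodgeConjecture.CorCM.MultiFieldWeil

open Literature.AlgebraicGeometry Literature.AlgebraicGeometry.Motives Literature.AlgebraicGeometry.HodgeTheory
open Literature.AlgebraicGeometry.ComplexMultiplication (IsCMTypeRealisation)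
open Literature.AlgebraicGeometry.Pohlmann1968
open Literature.AlgebraicTopology.SingularHomology
open Literature.NumberTheory.ComplexMultiplication
open Summit.HodgeConjecture.CorCM.SexticOcticWeil (typeCount_fourfold_of_frameS)
open Summit.HodgeConjecture.CorCM.SexticDecicWeil (typeCount_sixfold_of_frameSD)
open Summit.HodgeConjecture.CorCM.OcticWeilMulti (typeCount_sixfold_of_frameO)
open Summit.HodgeConjecture.CorCM.DihedralSexticPairCurve (weilClassesOf_biproduct_le_algebraicClasses_of_biprod)
open Summit.HodgeConjecture.CorCM.PairWeights

open scoped Classical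

variable {I : Type} {r : ℕ} {Kf : I → Type} [∀ i, Field (Kf i)] [∀ i, NumberField (Kf i)] [∀ i, IsCMField (Kf i)]
  {i₀ : I} {is : Fin r → I} {τ : Kf i₀ →+* ℂ} {im : ∀ m : Fin r, Kf i₀ →+* Kf (is m)}
  {A : Fin (r + 1) → AbelianVariety ℂ} {Φ : ∀ j : Fin (r + 1), CMType (Kf (mfSlots i₀ is j))}
  {ι : ∀ j, 𝓞 (Kf (mfSlots i₀ is j)) →+* End (A j)}
  {θ : ∀ j, Kf (mfSlots i₀ is j) →+* Module.End ℂ (complexBetti (A j).X 1)}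
  {δ : 𝓞 (Kf i₀)} {d : ℕ}

/-- **A SEXTIC `(1,2)`-slot (`n = 3`, one member over `τ`, `c = 1`, `w = 2`): the Weil plane of `B_m ⊞ E` from Markman's FOURFOLD theorem.**
[cite: Markman2025SurveySecant, Thm. 1.2 and §11.5 Step 2] [cite: vanGeemen1994HodgeAV, 4.9–4.10] -/
theorem weilHyp_of_markman_fourfold (hW4 : Markman2025_weilClasses_algebraic_abelianFourfold) (m : Fin r)
    (h6 : Module.finrank ℚ (Kf (is m)) = 6) (h2 : Module.finrank ℚ (Kf i₀) = 2) (hd : 0 < d) (hδ : ((δ : Kf i₀)) ^ 2 = -(d : Kf i₀))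
    (hA : ∀ j, IsCMTypeRealisation (Φ j) (A j) (ι j) (θ j))
    (e₁ : (Kf (is m) →+* ℂ) ≃ Fin 3 × Bool) (he_sign : ∀ s, (e₁ s).2 = true ↔ s.comp (im m) = τ)
    (hΦm : ∀ s : Kf (is m) →+* ℂ, s ∈ (Φ m.succ).1 ↔ (e₁ s).2 = decide ((e₁ s).1 = 0))
    (hΨ : ∀ σ : Kf i₀ →+* ℂ, σ ∈ (Φ 0).1 ↔ σ = τ) :
    weilClassesOf (⨁ fun i => A (partSlots 1 m i)) (biproduct.map fun i => ι (partSlots 1 m i) (δfam im δ (partSlots 1 m i))) 2 d ≤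
      algebraicClasses (⨁ fun i => A (partSlots 1 m i)).X 2 := by
  have hW : weilClassesOf (A m.succ ⊞ A 0) (biprod.map (ι m.succ (RingOfIntegers.mapRingHom (im m) δ)) (ι 0 δ)) 2 d ≤
      algebraicClasses (A m.succ ⊞ A 0).X 2 :=
    WeilFourfold.weilClassesOf_le_algebraicClasses_cmThreefold_biprod_cmCurve hW4 h6 h2 (im m) (hA m.succ) (hA 0) hd hδ
      fun τ' => typeCount_fourfold_of_frameS h2 he_sign hΦm hΨ τ'
  exact weilClassesOf_biproduct_le_algebraicClasses_of_biprod (A := fun i => A (partSlots 1 m i))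
    (fun i => ι (partSlots 1 m i) (δfam im δ (partSlots 1 m i))) hW

/-- **An OCTIC `(1,3)`-slot (`n = 4`, one member over `τ`, `c = 2`, `w = 3`): the Weil plane of `B_m ⊞ E ⊞ E` from Markman's HYPERBOLIC-SIXFOLD
theorem.** [cite: Markman2025SecantWeil, Thm 1.5.1] [cite: Deligne1982HodgeCycles, §5 (c)] -/
theorem weilHyp_of_markman_sixfold_octic (hM6 : Markman2025_weilClasses_algebraic_hyperbolicSixfold) (m : Fin r)
    (h8 : Module.finrank ℚ (Kf (is m)) = 8) (h2 : Module.finrank ℚ (Kf i₀) = 2) (hd : 0 < d) (hδ : ((δ : Kf i₀)) ^ 2 = -(d : Kf i₀))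
    (hA : ∀ j, IsCMTypeRealisation (Φ j) (A j) (ι j) (θ j))
    (e₂ : (Kf (is m) →+* ℂ) ≃ Fin 4 × Bool) (he_sign : ∀ s, (e₂ s).2 = true ↔ s.comp (im m) = τ)
    (hΦm : ∀ s : Kf (is m) →+* ℂ, s ∈ (Φ m.succ).1 ↔ (e₂ s).2 = decide ((e₂ s).1 = 0))
    (hΨ : ∀ σ : Kf i₀ →+* ℂ, σ ∈ (Φ 0).1 ↔ σ = τ) :
    weilClassesOf (⨁ fun i => A (partSlots 2 m i)) (biproduct.map fun i => ι (partSlots 2 m i) (δfam im δ (partSlots 2 m i))) 3 d ≤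
      algebraicClasses (⨁ fun i => A (partSlots 2 m i)).X 3 := by
  have hP : ((Finset.univ : Finset (Fin 4)).filter fun a => (fun (_ : Fin 1) (a : Fin 4) => decide (a = 0)) 0 a = true).card = 1 := by
    decide
  have hW : weilClassesOf (((A m.succ).prod (A 0)).prod (A 0))
      (AbelianVariety.prodLift
        (AbelianVariety.fst ((A m.succ).prod (A 0)) (A 0) ≫
          AbelianVariety.prodLift (AbelianVariety.fst (A m.succ) (A 0) ≫ ι m.succ (RingOfIntegers.mapRingHom (im m) δ))
            (AbelianVariety.snd (A m.succ) (A 0) ≫ ι 0 δ))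
        (AbelianVariety.snd ((A m.succ).prod (A 0)) (A 0) ≫ ι 0 δ)) 3 d ≤ algebraicClasses (((A m.succ).prod (A 0)).prod (A 0)).X 3 :=
    OcticCurveFourfold.weilClassesOf_le_algebraicClasses_cmFourfold_prod_cmCurve_prod_cmCurve_of_markmanSixfold hM6 h8 h2 (im m) (hA m.succ)
      (hA 0) hd hδ fun τ' => typeCount_sixfold_of_frameO (P := fun (_ : Fin 1) (a : Fin 4) => decide (a = 0)) (m := 0) h2 he_sign hP hΦm hΨ τ'
  exact OcticCurveFourfold.weilClassesOf_biproduct₃_le_algebraicClasses_of_prod (A := fun i => A (partSlots 2 m i))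
    (fun i => ι (partSlots 2 m i) (δfam im δ (partSlots 2 m i))) hW

/-- **A DECIC `(2,3)`-slot (`n = 5`, two members over `τ`, `c = 1`, `w = 3`): the Weil plane of `B_m ⊞ E` from Markman's HYPERBOLIC-SIXFOLD theorem.**
[cite: Markman2025SecantWeil, Thm 1.5.1] [cite: vanGeemen1994HodgeAV, 4.9–4.10] -/
theorem weilHyp_of_markman_sixfold_decic (hM6 : Markman2025_weilClasses_algebraic_hyperbolicSixfold) (m : Fin r)
    (h10 : Module.finrank ℚ (Kf (is m)) = 10) (h2 : Module.finrank ℚ (Kf i₀) = 2) (hd : 0 < d) (hδ : ((δ : Kf i₀)) ^ 2 = -(d : Kf i₀))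
    (hA : ∀ j, IsCMTypeRealisation (Φ j) (A j) (ι j) (θ j))
    (e₃ : (Kf (is m) →+* ℂ) ≃ Fin 5 × Bool) (he_sign : ∀ s, (e₃ s).2 = true ↔ s.comp (im m) = τ)
    (hΦm : ∀ s : Kf (is m) →+* ℂ, s ∈ (Φ m.succ).1 ↔ (e₃ s).2 = decide ((e₃ s).1 = 0 ∨ (e₃ s).1 = 1))
    (hΨ : ∀ σ : Kf i₀ →+* ℂ, σ ∈ (Φ 0).1 ↔ σ = τ) :
    weilClassesOf (⨁ fun i => A (partSlots 1 m i)) (biproduct.map fun i => ι (partSlots 1 m i) (δfam im δ (partSlots 1 m i))) 3 d ≤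
      algebraicClasses (⨁ fun i => A (partSlots 1 m i)).X 3 := by
  have hW : weilClassesOf ((A m.succ).prod (A 0))
      (AbelianVariety.prodLift (AbelianVariety.fst (A m.succ) (A 0) ≫ ι m.succ (RingOfIntegers.mapRingHom (im m) δ))
        (AbelianVariety.snd (A m.succ) (A 0) ≫ ι 0 δ)) 3 d ≤ algebraicClasses ((A m.succ).prod (A 0)).X 3 :=
    DecicCurveFivefold.weilClassesOf_le_algebraicClasses_cmFivefold_prod_cmCurve_of_markmanSixfold hM6 h10 h2 (im m) (hA m.succ) (hA 0) hd hδ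
      fun τ' => typeCount_sixfold_of_frameSD h2 he_sign hΦm hΨ τ'
  exact weilClassesOf_biproduct_le_algebraicClasses_of_prod (A := fun i => A (partSlots 1 m i))
    (fun i => ι (partSlots 1 m i) (δfam im δ (partSlots 1 m i))) hW

end Summit.HodgeConjecture.CorCM.MultiFieldWeil

end
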